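import Mathlib
import Summits.ResolutionOfSingularities.ResolutionOfSingularities.Theses.Valuative
import Summits.ResolutionOfSingularities.ResolutionOfSingularities.Theses.CyclicCovers
import Literature.AlgebraicGeometry.Resolution.ProperModelsPatchingGluing
import Literature.AlgebraicGeometry.Morphisms.OpenGluingProofs
import Literature.AlgebraicGeometry.Morphisms.NagataCompactification
import Summits.ResolutionOfSingularities.ResolutionOfSingularities.Theorems.SandwichedSingularitiesResolution
import Summits.ResolutionOfSingularities.ResolutionOfSingularities.Theorems.SandwichedSingularitiesResolutionSlices
import Summits.ResolutionOfSingularities.ResolutionOfSingularities.Theorems.ValuativePatchingRelRegLeificationOfSandwichedLocus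
import Summits.ResolutionOfSingularities.ResolutionOfSingularities.Theorems.ValuativePatchingRelSandwichedBridges
import Literature.AlgebraicGeometry.Resolution.ResolutionLU
import Summits.ResolutionOfSingularities.ResolutionOfSingularities.Theorems.ValuativePatchingRelBlowupBridge
import Summits.ResolutionOfSingularities.ResolutionOfSingularities.Theorems.ValuativePatchingRelBlowupResolution
import Summits.ResolutionOfSingularities.ResolutionOfSingularities.Theorems.ValuativePatchingRelStrongBlowup
import Literature.AlgebraicGeometry.Morphisms.NagataCompactificationProofs

/-!
# ResolutionOfSingularities / Valuative — crux `PatchingRel` closed modulo Nagata compactification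
# and strong resolution of sandwiched schemes (line `sandwiched-gluing`, capstone)

Crux `stmt-ResolutionOfSingularities-0642`, decl `Valuative.PatchingRel` (= `CyclicCovers.PatchingRel`,
the same term): `∀ p prime, LUrel_p → ResolutionInChar.{0} p` — Zariski's patching of relative local
uniformizations into one resolution, OPEN as an implication in dimension `≥ 4`.

The line `sandwiched-gluing` (Zariski patching with PROPER models of the function field; two-model
patching = RegLe-ification of one morphism applied twice on the join; RegLe-ification = glue a
strong resolution of the sandwiched piece `φ⁻¹(Reg Y) → Reg Y` to `M ∖ cl Sing φ⁻¹(Reg Y)` along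
`Reg`, then Nagata-compactify) reduces the crux, sorry-free and in every dimension, to exactly two
inputs:

* the NAMED FACT `Literature.AlgebraicGeometry.Morphisms.NagataCompactification` (Conrad 2007,
  Thm. 4.1; a published theorem, literature debt — registered stub `stub_nagataCompactification`),
* the OPEN ATOM `Literature.AlgebraicGeometry.Resolution.SandwichedStrongResolution p` for every
  prime `p` (strong resolution of integral schemes proper-birational over a regular variety of
  characteristic `p`; dimension `≤ 3` is Cossart–Piltant 2019 Thm. 1.1, dimension `≥ 4` is open —
  registered stub `stub_sandwichedStrongResolution`).

`patchingRel_of_nagata_of_sandwiched` is that reduction (registered stub of the crux item; a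
CONDITIONAL result: the item stays open). Its pieces are all in the tree twice over: as the
line's five landed stubs (`Theorems/ValuativePatchingRel{ResolvingSystem, RegLeificationOfLocal,
LocalRegLeification, OpenGluing, ProperExtension}.lean`) and as the Literature theorems they wrap
(`ZariskiPatchingProperModels`, `ProperModelsRegLeification`, `LocalRegLeificationOfSandwiched`,
`Morphisms.OpenGluingProofs` — which DISCHARGES the two-piece gluing fact `OpenGluing` from
Mathlib's pushouts —, `ProperModelsExtension`, and the refuter-assembled
`ProperModelsPatchingGluing` whose `SandwichedGluing.resolutionInChar_of_nagata_openGluing_sand`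
is used below, keeping this file's import closure small).
-/

-- `Summit.<Summit>.<Sub>.Theorems` with `Sub = Summit` (single-conjunct summit, D-0017): the duplicated
-- namespace component is the tree layout.
set_option linter.dupNamespace false

noncomputable section

open CategoryTheory AlgebraicGeometry
open Literature.AlgebraicGeometry.Resolution Literature.AlgebraicGeometry.Morphisms

namespace Summit.ResolutionOfSingularities.ResolutionOfSingularities.Theorems

/-- Per-prime slice: in characteristic `p`, Nagata compactification, `SAND⁺(p)` and relative
local uniformization `LUrel_p` give `ResolutionInChar.{0} p`; the two-piece gluing input of the
line is discharged (`OpenGluing_holds`). [cite: Piltant2013, Prop. 5.1 and Cor. 5.7] -/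
theorem resolutionInChar_of_nagata_of_sandwiched_of_lurel (p : ℕ) (hN : NagataCompactification.{0})
    (hS : SandwichedStrongResolution.{0} p)
    (hLU : ∀ (k K : Type) [Field k] [CharP k p] [Field K] [Algebra k K],
      (⊤ : IntermediateField k K).FG → ∀ O : ValuationSubring K,
        (∀ c : k, algebraMap k K c ∈ O) → ∀ R : Subalgebra k K, R.FG →
          R.toSubring ≤ O.toSubring →
            ∃ (A : Subalgebra k K) (h : A.toSubring ≤ O.toSubring), R ≤ A ∧ A.FG ∧
              IsFractionRing A K ∧ IsRegularLocalRing (Localization.AtPrime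
                (Ideal.comap (Subring.inclusion h) (IsLocalRing.maximalIdeal O)))) :
    ResolutionInChar.{0} p :=
  SandwichedGluing.resolutionInChar_of_nagata_openGluing_sand p hN OpenGluing_holds hS hLU

/-- **Crux `PatchingRel` modulo Nagata compactification and strong resolution of sandwiched
schemes** (line `sandwiched-gluing`; Zariski 1944 / Piltant 2013 Prop. 5.1 and Cor. 5.7 with
`P = P_reg`, carried out with proper models in every dimension): if separated finite-type morphisms
to qcqs schemes admit compactifications (`NagataCompactification`) and, for every prime `p`,
integral schemes proper-birational over regular varieties of characteristic `p` admit resolutions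
that are isomorphisms over their regular loci (`SandwichedStrongResolution p`), then relative local
uniformization in characteristic `p` implies resolution of singularities in characteristic `p`,
for every prime `p`. CONDITIONAL: both hypotheses are open stubs of the crux item (a named fact
and the residual atom). [cite: Piltant2013, Prop. 5.1 and Cor. 5.7] -/
theorem patchingRel_of_nagata_of_sandwiched : NagataCompactification.{0} →
    (∀ p : ℕ, p.Prime → SandwichedStrongResolution.{0} p) →
    Summit.ResolutionOfSingularities.ResolutionOfSingularities.Theses.Valuative.PatchingRel :=
  fun hN hS p hp hLU => resolutionInChar_of_nagata_of_sandwiched_of_lurel p hN (hS p hp) hLU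

/-- The same reduction for the `CyclicCovers` copy of the crux (route `CyclicCovers`, rank 6),
which is the same term. [folklore] -/
theorem cyclicCovers_patchingRel_of_nagata_of_sandwiched : NagataCompactification.{0} →
    (∀ p : ℕ, p.Prime → SandwichedStrongResolution.{0} p) →
    Summit.ResolutionOfSingularities.ResolutionOfSingularities.Theses.CyclicCovers.PatchingRel :=
  patchingRel_of_nagata_of_sandwiched

end Summit.ResolutionOfSingularities.ResolutionOfSingularities.Theorems

end

/-!
## Gen-1 cut (2026-08-16): the atom SANDᴸ — no gluing, no compactification, no slack

The gen-1 lead of the line replaced the strong atom by the conjecture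
`SandwichedLocusResolution p` (`Theorems/SandwichedSingularitiesResolution.lean`: a variety is
resolvable OVER any open with sandwiched singularities), which RegLe-ification consumes directly
(`stub_regLeification_of_sandwichedLocus`). Since `ResolutionInChar p ⇒` SANDᴸ(p) is formal, the
crux is EQUIVALENT, with no named-fact hypothesis at all, to "relative local uniformization
implies SANDᴸ" prime by prime (`patchingRel_iff_lurel_imp_sandwichedLocus`), resolution in
characteristic `p` is `LUrel_p ∧ SANDᴸ(p)` (`resolutionInChar_iff_lurel_and_sandwichedLocus`),
and modulo `CossartPiltant2019` the residual open content is SANDᴸ in dimension `> 3`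
(`patchingRel_of_cossartPiltant_of_sandwichedLocusDimGt`). The absolute form SANDʷ with Nagata
compactification also suffices (`patchingRel_of_nagata_of_sandwichedWeak`).
-/

noncomputable section

namespace Summit.ResolutionOfSingularities.ResolutionOfSingularities.Theorems

open CategoryTheory AlgebraicGeometry
open Literature.AlgebraicGeometry.Resolution Literature.AlgebraicGeometry.Morphisms

/-- Per-prime slice of the gen-1 capstone, UNCONDITIONAL in its named inputs: SANDᴸ(p) and
relative local uniformization `LUrel_p` give `ResolutionInChar.{0} p` (RegLe-ification from
SANDᴸ directly; two-model patching = RegLe-ification twice on the join; Zariski's resolving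
system with proper models). [cite: Piltant2013, Prop. 5.1 and Cor. 5.7] -/
theorem resolutionInChar_of_sandwichedLocus_of_lurel (p : ℕ)
    (hS : SandwichedLocusResolution.{0} p)
    (hLU : ∀ (k K : Type) [Field k] [CharP k p] [Field K] [Algebra k K],
      (⊤ : IntermediateField k K).FG → ∀ O : ValuationSubring K,
        (∀ c : k, algebraMap k K c ∈ O) → ∀ R : Subalgebra k K, R.FG →
          R.toSubring ≤ O.toSubring →
            ∃ (A : Subalgebra k K) (h : A.toSubring ≤ O.toSubring), R ≤ A ∧ A.FG ∧
              IsFractionRing A K ∧ IsRegularLocalRing (Localization.AtPrime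
                (Ideal.comap (Subring.inclusion h) (IsLocalRing.maximalIdeal O)))) :
    ResolutionInChar.{0} p :=
  resolutionInChar_of_properTwoModelPatching_of_relLU
    (SandwichedGluing.twoModelPatching_of_regLeification p
      (stub_regLeification_of_sandwichedLocus p hS)) hLU

/-- **Crux `PatchingRel` from resolution over sandwiched-singularity opens** (gen-1 capstone of
line `sandwiched-gluing`, NO named-fact hypothesis): if SANDᴸ(p) holds for every prime `p`, then
relative local uniformization implies resolution of singularities in every prime characteristic.
CONDITIONAL only on the open conjecture `SandwichedLocusResolution` (registered stub of the crux
item). [cite: Piltant2013, Prop. 5.1 and Cor. 5.7] -/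
theorem patchingRel_of_sandwichedLocus :
    (∀ p : ℕ, p.Prime → SandwichedLocusResolution.{0} p) →
    Summit.ResolutionOfSingularities.ResolutionOfSingularities.Theses.Valuative.PatchingRel :=
  fun hS p hp hLU => resolutionInChar_of_sandwichedLocus_of_lurel p (hS p hp) hLU

/-- The same for the `CyclicCovers` copy of the crux (the same term). [folklore] -/
theorem cyclicCovers_patchingRel_of_sandwichedLocus :
    (∀ p : ℕ, p.Prime → SandwichedLocusResolution.{0} p) →
    Summit.ResolutionOfSingularities.ResolutionOfSingularities.Theses.CyclicCovers.PatchingRel :=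
  patchingRel_of_sandwichedLocus

/-- **No slack, unconditionally: the crux is EQUIVALENT to "relative local uniformization
implies SANDᴸ, prime by prime"** — `⇐` is the capstone; `⇒` because `ResolutionInChar p ⇒`
SANDᴸ(p) is formal (`sandwichedLocusResolution_of_resolutionInChar`). Zariski's reduction of
"LU ⇒ resolution" to the resolution of sandwiched singularities loses nothing and needs no
compactification theorem. [folklore] -/
theorem patchingRel_iff_lurel_imp_sandwichedLocus :
    Summit.ResolutionOfSingularities.ResolutionOfSingularities.Theses.Valuative.PatchingRel ↔
      ∀ p : ℕ, p.Prime →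
        (∀ (k K : Type) [Field k] [CharP k p] [Field K] [Algebra k K],
          (⊤ : IntermediateField k K).FG → ∀ O : ValuationSubring K,
            (∀ c : k, algebraMap k K c ∈ O) → ∀ R : Subalgebra k K, R.FG →
              R.toSubring ≤ O.toSubring →
                ∃ (A : Subalgebra k K) (h : A.toSubring ≤ O.toSubring), R ≤ A ∧ A.FG ∧
                  IsFractionRing A K ∧ IsRegularLocalRing (Localization.AtPrime
                    (Ideal.comap (Subring.inclusion h) (IsLocalRing.maximalIdeal O)))) →
          SandwichedLocusResolution.{0} p :=
  ⟨fun h p hp hLU => sandwichedLocusResolution_of_resolutionInChar (h p hp hLU),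
    fun h p hp hLU => resolutionInChar_of_sandwichedLocus_of_lurel p (h p hp hLU) hLU⟩

/-- **Resolution in characteristic `p` ⟺ relative local uniformization ∧ SANDᴸ(p)**, for every
prime `p`, unconditionally (`⇒`: `lurel_of_resolutionInChar` and the formal slice; `⇐`: the
capstone). [cite: Piltant2013, p. 2 and Cor. 5.7] -/
theorem resolutionInChar_iff_lurel_and_sandwichedLocus (p : ℕ) (hp : p.Prime) :
    ResolutionInChar.{0} p ↔
      (∀ (k K : Type) [Field k] [CharP k p] [Field K] [Algebra k K],
          (⊤ : IntermediateField k K).FG → ∀ O : ValuationSubring K,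
            (∀ c : k, algebraMap k K c ∈ O) → ∀ R : Subalgebra k K, R.FG →
              R.toSubring ≤ O.toSubring →
                ∃ (A : Subalgebra k K) (h : A.toSubring ≤ O.toSubring), R ≤ A ∧ A.FG ∧
                  IsFractionRing A K ∧ IsRegularLocalRing (Localization.AtPrime
                    (Ideal.comap (Subring.inclusion h) (IsLocalRing.maximalIdeal O)))) ∧
        SandwichedLocusResolution.{0} p :=
  ⟨fun h => ⟨lurel_of_resolutionInChar p hp h, sandwichedLocusResolution_of_resolutionInChar h⟩,
    fun h => resolutionInChar_of_sandwichedLocus_of_lurel p h.2 h.1⟩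

/-- **The summit, refactored**: resolution of singularities in positive characteristic is
equivalent to the conjunction, over all primes `p`, of relative local uniformization `LUrel_p`
and resolution over sandwiched-singularity opens SANDᴸ(p). [cite: Piltant2013, p. 2 and Cor. 5.7] -/
theorem resolutionOfSingularities_iff_lurel_and_sandwichedLocus :
    Literature.AlgebraicGeometry.Resolution.ResolutionOfSingularities ↔
      ∀ p : ℕ, p.Prime →
        (∀ (k K : Type) [Field k] [CharP k p] [Field K] [Algebra k K],
            (⊤ : IntermediateField k K).FG → ∀ O : ValuationSubring K,
              (∀ c : k, algebraMap k K c ∈ O) → ∀ R : Subalgebra k K, R.FG →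
                R.toSubring ≤ O.toSubring →
                  ∃ (A : Subalgebra k K) (h : A.toSubring ≤ O.toSubring), R ≤ A ∧ A.FG ∧
                    IsFractionRing A K ∧ IsRegularLocalRing (Localization.AtPrime
                      (Ideal.comap (Subring.inclusion h) (IsLocalRing.maximalIdeal O)))) ∧
          SandwichedLocusResolution.{0} p :=
  ⟨fun h p hp => (resolutionInChar_iff_lurel_and_sandwichedLocus p hp).mp (h p hp),
    fun h p hp => (resolutionInChar_iff_lurel_and_sandwichedLocus p hp).mpr (h p hp)⟩

/-- The gen-1 capstone in terms of the ABSOLUTE atom: Nagata compactification and SANDʷ(p) for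
every prime `p` give the crux (`sandwichedLocusResolution_of_nagata_of_sandwichedWeak`).
CONDITIONAL on the named fact `NagataCompactification` (Conrad 2007, Thm. 4.1) and the open
conjecture `SandwichedSingularitiesResolution`. [cite: Conrad2007, Thm. 4.1 (use)] -/
theorem patchingRel_of_nagata_of_sandwichedWeak (hN : NagataCompactification.{0})
    (hS : ∀ p : ℕ, p.Prime → SandwichedSingularitiesResolution.{0} p) :
    Summit.ResolutionOfSingularities.ResolutionOfSingularities.Theses.Valuative.PatchingRel :=
  patchingRel_of_sandwichedLocus fun p hp =>
    sandwichedLocusResolution_of_nagata_of_sandwichedWeak p hN (hS p hp)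

/-- **The residual open content, isolated**: modulo the named fact `CossartPiltant2019`
(Thm. 1.1, weak form) the crux `PatchingRel` follows from SANDᴸ in dimension `> 3` alone —
resolution over sandwiched-singularity opens of varieties of dimension `≥ 4` in every prime
characteristic. [cite: CossartPiltant2019, Thm. 1.1] -/
theorem patchingRel_of_cossartPiltant_of_sandwichedLocusDimGt (hCP : CossartPiltant2019.{0})
    (hS : ∀ p : ℕ, p.Prime → SandwichedLocusResolutionDimGt.{0} p 3) :
    Summit.ResolutionOfSingularities.ResolutionOfSingularities.Theses.Valuative.PatchingRel :=
  patchingRel_of_sandwichedLocus fun p hp =>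
    (sandwichedLocusResolution_iff_dimGt_three hCP p).mpr (hS p hp)

end Summit.ResolutionOfSingularities.ResolutionOfSingularities.Theorems

end

/-!
## v3 cut (continuation lead c1, 2026-08-16): the atom in BLOW-UP FORMAT — no compactification left anywhere

The gen-1 atom SANDᴸ is a statement about pairs `(M, O)`; its absolute form SANDʷ (about a
variety `X` regular off a sandwiched open) gives it back only modulo Nagata compactification. The
v3 cut replaces the compactification theorem by the FORMAT in which resolution theorems are
proved — blowing up an ideal sheaf: a blowing up of an open `O ⊆ M` extends to the blowing up of
`M` along the push-forward ideal (`Theorems/ValuativePatchingRelBlowupExtension.lean`,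
`…BlowupBridge.lean`), and a Sing-admissible blowing up of the sandwiched PIECE `V ⊆ X` extends
to `X` because `Sing V = Sing X` is closed in `X` (`…StrongBlowup.lean`). All arrows below are
theorems of the tree (no named fact):

  `StrongBlowupRes_p ⇒ SAND⁺ᵇ_p ⇒ SANDᵇ_p ⇒ SANDᴸ_p ⇒ RegLeification_p ⇒ TMP_p`,
  `StrongBlowupRes_p ⇒ BlowupRes_p ⇒ SANDᵇ_p`, `BlowupRes_p ⇒ Res_p ⇒ SANDᴸ_p`,

so the crux follows from each of `∀ p prime, SANDᵇ_p` (resolution by ONE blowing up of varieties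
with sandwiched singular locus) and `∀ p prime, SAND⁺ᵇ_p` (Sing-admissible blow-up
desingularization of sandwiched varieties — the gen-0 strong atom in blow-up format, with its
Nagata and gluing debts gone), and, modulo `CossartPiltant2019`, from the dimension-`> 3` slice
`∀ p prime, SANDᵇDimGt p 3`. Zariski's patching (Piltant 2013, Prop. 5.1), for a local resolver
whose output is a Sing-admissible blowing up, needs no compactification, no gluing, no bad points
and no lower-dimensional resolution, in any dimension.
-/

noncomputable section

namespace Summit.ResolutionOfSingularities.ResolutionOfSingularities.Theorems

open CategoryTheory AlgebraicGeometry
open Literature.AlgebraicGeometry.Resolution Literature.AlgebraicGeometry.Morphisms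

/-- Per-prime slice of the v3 capstone: SANDᵇ(p) and relative local uniformization `LUrel_p`
give `ResolutionInChar.{0} p` (the Nagata-free bridge `sandwichedLocusResolution_of_sandwichedBlowup`,
then the gen-1 slice). [cite: Piltant2013, Prop. 5.1 and Cor. 5.7] -/
theorem resolutionInChar_of_sandwichedBlowup_of_lurel (p : ℕ)
    (hS : SandwichedBlowupResolution.{0} p)
    (hLU : ∀ (k K : Type) [Field k] [CharP k p] [Field K] [Algebra k K],
      (⊤ : IntermediateField k K).FG → ∀ O : ValuationSubring K,
        (∀ c : k, algebraMap k K c ∈ O) → ∀ R : Subalgebra k K, R.FG →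
          R.toSubring ≤ O.toSubring →
            ∃ (A : Subalgebra k K) (h : A.toSubring ≤ O.toSubring), R ≤ A ∧ A.FG ∧
              IsFractionRing A K ∧ IsRegularLocalRing (Localization.AtPrime
                (Ideal.comap (Subring.inclusion h) (IsLocalRing.maximalIdeal O)))) :
    ResolutionInChar.{0} p :=
  resolutionInChar_of_sandwichedLocus_of_lurel p (sandwichedLocusResolution_of_sandwichedBlowup hS) hLU

/-- **Crux `PatchingRel` from resolution by ONE blowing up of varieties with sandwiched singular
locus** (v3 capstone of line `sandwiched-gluing`; registered stub `patchingRel_of_sandwichedBlowup`;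
NO named-fact hypothesis): if SANDᵇ(p) holds for every prime `p`, relative local uniformization
implies resolution of singularities in every prime characteristic. CONDITIONAL only on the open
conjecture `SandwichedBlowupResolution`. [cite: Piltant2013, Prop. 5.1 and Cor. 5.7] -/
theorem patchingRel_of_sandwichedBlowup :
    (∀ p : ℕ, p.Prime → SandwichedBlowupResolution.{0} p) →
    Summit.ResolutionOfSingularities.ResolutionOfSingularities.Theses.Valuative.PatchingRel :=
  fun hS => patchingRel_of_sandwichedLocus fun p hp => sandwichedLocusResolution_of_sandwichedBlowup (hS p hp)

/-- The same for the `CyclicCovers` copy of the crux (the same term). [folklore] -/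
theorem cyclicCovers_patchingRel_of_sandwichedBlowup :
    (∀ p : ℕ, p.Prime → SandwichedBlowupResolution.{0} p) →
    Summit.ResolutionOfSingularities.ResolutionOfSingularities.Theses.CyclicCovers.PatchingRel :=
  patchingRel_of_sandwichedBlowup

/-- **Crux `PatchingRel` from Sing-admissible blow-up desingularization of SANDWICHED VARIETIES**
(the gen-0 strong atom in blow-up format; v3): if every sandwiched variety in every prime
characteristic admits a Sing-admissible blowing up with regular source (SAND⁺ᵇ(p)), then relative
local uniformization implies resolution — with no compactification theorem and no gluing fact
(contrast `patchingRel_of_nagata_of_sandwiched`). CONDITIONAL only on the open conjecture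
`SandwichedStrongBlowupResolution`. [cite: Piltant2013, Prop. 5.1 and Cor. 5.7] -/
theorem patchingRel_of_sandwichedStrongBlowup :
    (∀ p : ℕ, p.Prime → SandwichedStrongBlowupResolution.{0} p) →
    Summit.ResolutionOfSingularities.ResolutionOfSingularities.Theses.Valuative.PatchingRel :=
  fun hS => patchingRel_of_sandwichedBlowup fun p hp =>
    sandwichedBlowupResolution_of_sandwichedStrongBlowup (hS p hp)

/-- The same for the `CyclicCovers` copy. [folklore] -/
theorem cyclicCovers_patchingRel_of_sandwichedStrongBlowup :
    (∀ p : ℕ, p.Prime → SandwichedStrongBlowupResolution.{0} p) →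
    Summit.ResolutionOfSingularities.ResolutionOfSingularities.Theses.CyclicCovers.PatchingRel :=
  patchingRel_of_sandwichedStrongBlowup

/-- **The residual open content in blow-up format, isolated**: modulo the named fact
`CossartPiltant2019` (Thm. 1.1, weak form, which settles SANDᴸ in dimension `≤ 3`) the crux
follows from SANDᵇ in dimension `> 3` alone — resolution by one blowing up of varieties of
dimension `≥ 4` with sandwiched singular locus, in every prime characteristic
(`sandwichedLocusResolutionDimGt_of_sandwichedBlowupDimGt`). [cite: CossartPiltant2019, Thm. 1.1] -/
theorem patchingRel_of_cossartPiltant_of_sandwichedBlowupDimGt (hCP : CossartPiltant2019.{0})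
    (hS : ∀ p : ℕ, p.Prime → SandwichedBlowupResolutionDimGt.{0} p 3) :
    Summit.ResolutionOfSingularities.ResolutionOfSingularities.Theses.Valuative.PatchingRel :=
  patchingRel_of_cossartPiltant_of_sandwichedLocusDimGt hCP fun p hp =>
    sandwichedLocusResolutionDimGt_of_sandwichedBlowupDimGt (hS p hp)

/-- **The format statements settle everything at once**: resolution by one Sing-admissible
blowing up of all varieties in characteristic `p` (`StrongBlowupResolutionInChar p`) gives
`ResolutionInChar p` outright (no local uniformization needed) AND every atom of the line; recorded
to make the lattice explicit: `StrongBlowupRes_p ⇒ BlowupRes_p ⇒ Res_p`. [folklore] -/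
theorem resolutionInChar_of_strongBlowupResolutionInChar {p : ℕ}
    (h : StrongBlowupResolutionInChar.{0} p) : ResolutionInChar.{0} p :=
  resolutionInChar_of_blowupResolutionInChar (blowupResolutionInChar_of_strongBlowupResolutionInChar h)

/-- **Where local uniformization enters, v3 form**: for a prime `p`, `LUrel_p` together with
SAND⁺ᵇ(p) — a statement about modifications of REGULAR varieties only — gives resolution of ALL
varieties in characteristic `p`. [cite: Piltant2013, Prop. 5.1 and Cor. 5.7] -/
theorem resolutionInChar_of_sandwichedStrongBlowup_of_lurel (p : ℕ)
    (hS : SandwichedStrongBlowupResolution.{0} p)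
    (hLU : ∀ (k K : Type) [Field k] [CharP k p] [Field K] [Algebra k K],
      (⊤ : IntermediateField k K).FG → ∀ O : ValuationSubring K,
        (∀ c : k, algebraMap k K c ∈ O) → ∀ R : Subalgebra k K, R.FG →
          R.toSubring ≤ O.toSubring →
            ∃ (A : Subalgebra k K) (h : A.toSubring ≤ O.toSubring), R ≤ A ∧ A.FG ∧
              IsFractionRing A K ∧ IsRegularLocalRing (Localization.AtPrime
                (Ideal.comap (Subring.inclusion h) (IsLocalRing.maximalIdeal O)))) :
    ResolutionInChar.{0} p :=
  resolutionInChar_of_sandwichedBlowup_of_lurel p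
    (sandwichedBlowupResolution_of_sandwichedStrongBlowup hS) hLU

/-- **The gen-0 capstone, debt-free**: Nagata compactification is a THEOREM of the tree
(`Literature.AlgebraicGeometry.Morphisms.NagataCompactification_holds`, Conrad 2007 Thm. 4.1 =
Stacks 0F41, proved there from Raynaud–Gruson flattening), so strong resolution of sandwiched
varieties in every prime characteristic ALONE gives the crux: `PatchingRel ⇐ ∀ p prime, SAND⁺_p`,
no named-fact hypothesis. (The v3 format upgrade `SAND⁺ ∧ Axiom4ᵇ ⇒ SAND⁺ᵇ`,
`Theorems/ValuativePatchingRelFormatUpgrade.lean`, relates this to the blow-up-format atoms.)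
[cite: Conrad2007, Thm. 4.1] -/
theorem patchingRel_of_sandwichedStrong
    (hS : ∀ p : ℕ, p.Prime → SandwichedStrongResolution.{0} p) :
    Summit.ResolutionOfSingularities.ResolutionOfSingularities.Theses.Valuative.PatchingRel :=
  patchingRel_of_nagata_of_sandwiched NagataCompactification_holds hS

/-- The same for the `CyclicCovers` copy of the crux. [folklore] -/
theorem cyclicCovers_patchingRel_of_sandwichedStrong
    (hS : ∀ p : ℕ, p.Prime → SandwichedStrongResolution.{0} p) :
    Summit.ResolutionOfSingularities.ResolutionOfSingularities.Theses.CyclicCovers.PatchingRel :=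
  patchingRel_of_sandwichedStrong hS

end Summit.ResolutionOfSingularities.ResolutionOfSingularities.Theorems

end
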